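import Mathlib
import Summits.MatrixMultiplication.MatrixMultiplication.Theses.NilpotentLieHosts
import Summits.MatrixMultiplication.MatrixMultiplication.Theorems.NilpotentLieHostsUnitriangularCostShapeStubProductModel
import Summits.MatrixMultiplication.MatrixMultiplication.Theorems.NilpotentLieHostsUnitriangularCostShapeStubModelHosts
import Summits.MatrixMultiplication.MatrixMultiplication.Theorems.NilpotentLieHostsUnitriangularCostShapeStubTruncatedMatrixCost

/-!
# Route `NilpotentLieHosts` — crux `HeisenbergEnvelopingCost` (stmt-MatrixMultiplication-7722), PROVED

Card (1a) of the route: there is `C` such that for every budget `s` and every TPP triple `X, Y, Z ⊂ U_3(ℤ)` with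
separating polynomials of `(1,1,2)`-weighted degree `≤ s`, `(|X||Y||Z|)^(ω/3) ≤ C (s+1)^(ω+1)`.

This is the `d = 3` case of the product-model proof of `UnitriangularCostShape` with the Casimir count made
explicit (`productModel_explicit 3`: `k = ⌊3/2⌋ = 1` Casimir variable `z = x₁₃`, `N ≤ c (s+1)`, `t ≤ c (s+1)`:
the truncated Schrödinger–Fock module of `U(𝔥₃)` over `ℂ[z]/(z^t)`), composed with `stub_modelHosts` (hosting
from separating polynomials) and `stub_truncatedMatrixCost` (`(nlp)^(ω/3) ≤ κ N^ω t`), and the bookkeeping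
`κ (c(s+1))^ω · c(s+1) = (κ c^ω c) (s+1)^(ω+1)`.
-/

set_option linter.dupNamespace false

noncomputable section

namespace Summit.MatrixMultiplication.MatrixMultiplication.Theorems

open scoped BigOperators Matrix

/-- **`HeisenbergEnvelopingCost`** (crux `stmt-MatrixMultiplication-7722` of route `NilpotentLieHosts`): TPP triples in
`U_3(ℤ)` with weighted-degree-`≤ s` separating polynomials satisfy `(|X||Y||Z|)^(ω/3) ≤ C (s+1)^(ω+1)`.
Proof: the `d = 3` product model (one Casimir variable), hosting, cost of the truncated matrix host. -/
theorem heisenbergEnvelopingCost_proof :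
    Summit.MatrixMultiplication.MatrixMultiplication.Theses.NilpotentLieHosts.HeisenbergEnvelopingCost := by
  obtain ⟨c, hc, hmodel⟩ := UnitriangularCostShape.productModel_explicit 3 le_rfl
  obtain ⟨κ, hκ, hcostk⟩ := UnitriangularCostShape.stub_truncatedMatrixCost (3 / 2)
  refine ⟨κ * c ^ Literature.Computability.AlgebraicComplexity.omega ℂ * c, ?_⟩
  intro s X Y Z hU _hT hS
  obtain ⟨t, N, hN, ht, ρ, hρ⟩ := hmodel s
  obtain ⟨α, β, γ, hhost⟩ := UnitriangularCostShape.stub_modelHosts 3 (3 / 2) t N s ρ X Y Z hρ hU hS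
  have hcost := hcostk t N X.card Y.card Z.card α β γ hhost
  set w : ℝ := Literature.Computability.AlgebraicComplexity.omega ℂ with hw
  have hw0 : 0 ≤ w :=
    zero_le_two.trans (Literature.Computability.AlgebraicComplexity.omega_two_le ℂ)
  have hs0 : (0 : ℝ) < (s : ℝ) + 1 := by positivity
  have hN' : (N : ℝ) ≤ c * ((s : ℝ) + 1) := by
    have e : (((3 : ℕ) : ℝ) * ((3 : ℕ) - 1) / 2 - ((3 / 2 : ℕ) : ℝ)) / 2 = 1 := by norm_num
    rw [e, Real.rpow_one] at hN
    exact hN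
  have ht' : (t : ℝ) ≤ c * ((s : ℝ) + 1) := by
    have e : (((3 / 2 : ℕ) : ℕ) : ℝ) = 1 := by norm_num
    rw [e, Real.rpow_one] at ht
    simpa using ht
  have hcw : (0 : ℝ) ≤ c ^ w := Real.rpow_nonneg hc.le w
  have h1 : (N : ℝ) ^ w ≤ c ^ w * ((s : ℝ) + 1) ^ w :=
    calc (N : ℝ) ^ w ≤ (c * ((s : ℝ) + 1)) ^ w := Real.rpow_le_rpow (Nat.cast_nonneg N) hN' hw0
      _ = c ^ w * ((s : ℝ) + 1) ^ w := Real.mul_rpow hc.le hs0.le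
  have ht1 : (t : ℝ) ^ (3 / 2) ≤ c * ((s : ℝ) + 1) := by
    rw [show (3 / 2 : ℕ) = 1 from rfl, pow_one]; exact ht'
  have h2 : (N : ℝ) ^ w * (t : ℝ) ^ (3 / 2) ≤ (c ^ w * ((s : ℝ) + 1) ^ w) * (c * ((s : ℝ) + 1)) :=
    mul_le_mul h1 ht1 (by positivity) (mul_nonneg hcw (Real.rpow_nonneg hs0.le _))
  have h3 : κ * ((c ^ w * ((s : ℝ) + 1) ^ w) * (c * ((s : ℝ) + 1))) =
      κ * c ^ w * c * ((s : ℝ) + 1) ^ (w + 1) := by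
    rw [Real.rpow_add hs0, Real.rpow_one]
    ring
  have hcard : ((X.card * Y.card * Z.card : ℕ) : ℝ) = (X.card : ℝ) * Y.card * Z.card := by
    simp only [Nat.cast_mul]
  calc ((X.card : ℝ) * Y.card * Z.card) ^ (w / 3)
      = ((X.card * Y.card * Z.card : ℕ) : ℝ) ^ (w / 3) := by rw [hcard]
    _ ≤ κ * (N : ℝ) ^ w * (t : ℝ) ^ (3 / 2) := hcost
    _ = κ * ((N : ℝ) ^ w * (t : ℝ) ^ (3 / 2)) := by ring
    _ ≤ κ * ((c ^ w * ((s : ℝ) + 1) ^ w) * (c * ((s : ℝ) + 1))) := mul_le_mul_of_nonneg_left h2 hκ.le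
    _ = κ * c ^ w * c * ((s : ℝ) + 1) ^ (w + 1) := h3

end Summit.MatrixMultiplication.MatrixMultiplication.Theorems

end
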